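import Summits.CriticalPhenomena.Ising3DConformalLimit.Theorems.PerfectScreeningGaussianLimitNotScreenedDepletionBound
import Summits.CriticalPhenomena.Ising3DConformalLimit.Theorems.EnergyNotSigmaSquaredGapForcesFarMergingSandwichTailTightnessAux
import HarnessLib

/-!
# Crux `CoulombImpliesNontrivial` (stmt-CriticalPhenomena-13885, route PerfectScreening r3), line
# `merging-is-expected-screening`: registered stub `stub_contactLowerBound`
# (the lattice CONTACT term: `P² ≥ G_L(a,c) G_L(c,b) / G_L(a,b)`)

In the free box `Λ_L ⊂ ℤ³` at `β_c(3)`, for `a, b, c, e ∈ Λ_L`, the merging probability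
`P² = P^{ab,ce}_{Λ_L}[a ↔ c]` (`twoCurrentMeet`, Aizenman–Duminil-Copin 2021 eq. (3.11)) is at least
the probability that `c` lies in the sourced cluster of `a` under `P^{ab,∅}_{Λ_L}`, which by the
switching lemma is EXACTLY `G_L(a,c) G_L(c,b) / G_L(a,b)` (`threePointRatio`): if `c ∈ C(a)` the two
clusters are glued.

Proof. The landed depletion bound `stub_depletionBound` (ADC21 App. A Lemma A.1 read as an
equality, file `…PerfectScreeningGaussianLimitNotScreenedDepletionBound`) with the class
`good C := (c ∈ C)` and `c' = 1`: its depletion hypothesis quantifies over `good` sets AVOIDING `c`,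
hence is vacuous, and it yields `P^{ab,∅}_{Λ_L}[c ∈ C(a)] ≤ P²`, where `C(a) = traceCluster L ω a`
is the cluster of `a` read in `Λ_{L+1} ⊇ Λ_L ∋ c`, so that `{c ∈ C(a)} = {a ↔ c}` (`openConn a c`).
The exact one-point density `law_real_openConn_eq` (file
`…EnergyNotSigmaSquaredGapForcesFarMergingSandwichTailTightnessAux`) identifies the left side with
`threePointRatio L a b c`. Everything is proved; nothing is defined or cited as a fact.
[AizenmanDuminilCopinAnnals2021, eq. (3.11), App. A Lemma A.1, Prop. A.3]
-/

noncomputable section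

namespace Summit.CriticalPhenomena.Ising3DConformalLimit.Cruxes.CoulombImpliesNontrivial.MergingIsExpectedScreening

open MeasureTheory Finset
open Literature.Probability.LatticeModels Literature.Probability.Percolation
open Summit.CriticalPhenomena.Ising3DConformalLimit.Cruxes.IsingEuclidUpgradeR4NonGaussian.FreeCovarianceDeltaDichotomy
  (boxG threePointRatio twoCurrentMeet)
open Summit.CriticalPhenomena.Ising3DConformalLimit.Cruxes.GaussianLimitNotScreened.KaramataAmplitudeBlindMerging
  (defectG traceCluster stub_depletionBound)
open Summit.CriticalPhenomena.Ising3DConformalLimit.EnergyNotSigmaSquaredGapForcesFarMergingSandwich.TailTightnessProof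
  (law_real_openConn_eq)
open scoped symmDiff

/-- For `c ∈ Λ_L ⊆ Λ_{L+1}`, the event `{c ∈ C(a)}` of the box cluster `traceCluster L ω a`
(the cluster of `a` read inside `Λ_{L+1}`) is the connection event `{a ↔ c}`. [folklore] -/
theorem setOf_mem_traceCluster_eq {L : ℕ} (a : Site 3) {c : Site 3} (hc : c ∈ box 3 L) :
    {ω : BondConfig (Site 3) | c ∈ traceCluster L ω a} = openConn a c := by
  ext ω
  simp [traceCluster, box_subset_box_succ 3 L hc]

/-- **Registered stub `stub_contactLowerBound`** (the lattice contact term of the merging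
probability): for `a, b, c, e ∈ Λ_L`, `G_L(a,c) G_L(c,b) / G_L(a,b) = P^{ab,∅}_{Λ_L}[c ∈ C(a)] ≤ P²`.
Proof: `stub_depletionBound` with `good C := (c ∈ C)`, `c' = 1` (vacuous depletion hypothesis),
`{c ∈ C(a)} = {a ↔ c}` (`setOf_mem_traceCluster_eq`) and the exact one-point density
`law_real_openConn_eq`. [cite: AizenmanDuminilCopinAnnals2021, eq. (3.11) and Appendix A, Lemma A.1, Proposition A.3] -/
theorem stub_contactLowerBound :
    ∀ (L : ℕ) (a b c e : Site 3), a ∈ box 3 L → b ∈ box 3 L → c ∈ box 3 L → e ∈ box 3 L → a ≠ b →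
      threePointRatio L a b c ≤ twoCurrentMeet L a b c e := by
  intro L a b c e ha hb hc he _
  have h := stub_depletionBound L a b c e ha hb hc he (fun C => c ∈ C) 1 zero_le_one le_rfl
    (fun C hC hcC _ _ => absurd hC hcC)
  rw [one_mul, setOf_mem_traceCluster_eq a hc] at h
  rwa [← law_real_openConn_eq ha hb hc]

end Summit.CriticalPhenomena.Ising3DConformalLimit.Cruxes.CoulombImpliesNontrivial.MergingIsExpectedScreening

end
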